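import Summits.BirchSwinnertonDyer.Rank1Residual.X10.UnitRoadProp38
import Summits.BirchSwinnertonDyer.Rank1Residual.X10.UnitRoadBSD
import HarnessLib

/-!
# Class X10b (N2), the UNIT ROAD and the TRIVIAL-PARTNER ROAD at `p = 3` off literal integer models,
# WITHOUT Kato 17.4, Greenberg's Thm. 4.1 and the `p ≥ 5` period fact — the integer-model consumers
# of `X10/UnitRoad` §1–§2 re-issued over `X10/UnitRoadProp38` (cell `b2b-bsdres`, unit
# `b2b-bsdres-x10` = N2 class lead, gen 26)

HONEST FRAMING (run/shared/lean/b2b/bsd-rank1-residual/, verbatim in every file): the goal of the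
cell is to DELETE the COMBINATION-SHAPED residual classes of the Birch–Swinnerton-Dyer formula for
ALL analytic-rank `≤ 1` elliptic curves over `ℚ` — "full BSD formula for every rank `≤ 1` curve in
class `C`" assembled STRICTLY from published theorems — so that the rank-`≤ 1` remainder becomes
exactly the CONSTRUCTION-SHAPED classes, which are TYPED (missing-input `Prop`s), NOT attempted.
This is not "finishing BSD". Theorems only; NO definition, NO named fact is introduced; class X10b
(`p = 3` good ordinary, `E[3]` irreducible, `ρ̄_{E,3}` onto a Cartan normaliser) keeps its label
CONSTRUCTION-SHAPED (NEEDS X_A3 = `MazurMainConjecture W 3`, referee R82.3 / RESIDUAL-MAP §I N2);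
nothing is booked by this file; everything is PER PAIR.

## What this file adds (x10 GEN 26, X10-AUDIT §32)

`X10/UnitRoadProp38` (this gen) proves Mazur's main conjecture with `μ = 0` at `(A,3)` for a curve
`A` with TRIVIAL `3`-primary arithmetic from the period unit `h3` ALONE (the algebraic side
`X(A/ℚ_∞) = 0` is Greenberg's Prop. 3.8, a theorem of the tree by team n1011; the analytic side is
x9 gen 5's integrality + interpolation). THIS FILE = the two integer-model consumers of GEN 24's
`X10/UnitRoad`, with the SAME literal-model hypotheses and the binders `hkato` (Kato 2004 Thm. 17.4
(1)), `hGr` (Greenberg 1999 Thm. 4.1) and `h5` (period unit at `p ≥ 5`) REMOVED: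

* §1 `subsingleton_dualSelmer_three_of_ainvs` (`X(E/ℚ_∞) = 0` off the literal model, NO named fact),
  `mazurMainConjecture_three_unitContent_of_ainvs_of_trivialArithmetic_prop38` /
  `mazurMainConjecture_three_of_ainvs_of_trivialArithmetic_prop38` — the UNIT ROAD (target `W` with
  `integralModelInt W = [a₁,…,a₆]`, `3 ∤ Δ`, `#W̃(𝔽₃) = n₃` with `3 ∤ 4 − n₃` and `3 ∤ n₃`, a
  Frobenius witness `ℓ` for the irreducibility of `E[3]`; census binders `htam`, `hL`, `hSel`;
  PUBLISHED `h3` only);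
* §2 `mazurMainConjecture_three_unitContent_of_ainvs_of_trivialPartner_prop38` /
  `mazurMainConjecture_three_of_ainvs_of_trivialPartner_prop38` — the TRIVIAL-PARTNER ROAD (target
  `W` ANY N2 cell, partner `A` with trivial `3`-primary arithmetic, certificate C1 `hC1`; PUBLISHED
  `h3` and Greenberg–Vatsal 2000 Thm. (1.4) `hGV` only).

* §3 `bsdp_three_of_ainvs_of_trivialPartner_rankZero_prop38` /
  `bsdp_three_of_ainvs_of_trivialPartner_rankOne_of_schneider_prop38` — GEN 25's `X10/UnitRoadBSD`
  §2 (`BSD(E,3)` for a cell congruent to a curve with trivial `3`-primary arithmetic) WITHOUT `hkato`,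
  `h5` (and, in rank one, without `hGr`: the rank-one skeleton
  `Rank1Residual.bsdp_of_mazurMainConjecture_of_analyticRank_eq_one_of_schneider_odd` does not use
  Greenberg's Thm. 4.1; the rank-zero skeleton does — CGLS Thm. 5.1.4's deduction —, so `hGr` stays
  displayed there as the MC ⇒ BSD bridge, no longer as an input of the main conjecture).

The per-pair records over these consumers (77 unit cells, 18 partner cells) are the sibling files
`X10/UnitRoadProp38Records*.lean` / `X10/UnitRoadPartnerProp38Records*.lean`. Per pair; no class
statement; nothing booked; N2 mark unchanged.

References: R. Greenberg, LNM 1716 (1999) Prop. 3.8 and Remark (pp. 95–96) [GreenbergLNM1716];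
R. Greenberg, V. Vatsal, Invent. Math. 142 (2000) Thm. (1.4), §3 Remark (3.4), Prop. (3.7)
[GreenbergVatsal2000]; B. Mazur, Invent. Math. 44 (1978) Prop. 6.3 (1), Cor. 4.1 [Mazur1978]; cell
files X10-AUDIT.md §32.
-/

set_option autoImplicit false

noncomputable section

open scoped Classical MatrixGroups ModularForm

open CongruenceSubgroup WeierstrassCurve Literature.NumberTheory.EllipticCurves
  Literature.NumberTheory.EllipticCurves.ModularForms Literature.NumberTheory.EllipticCurves.Rank1Residual
  Literature.NumberTheory.EllipticCurves.Rank1Residual.X11RankOneCertificates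
  Summit.BirchSwinnertonDyer.BirchSwinnertonDyer.Rank1Residual.IntModel
  Summit.BirchSwinnertonDyer.BirchSwinnertonDyer.Rank1Residual.X11RankOne
  Summit.BirchSwinnertonDyer.BirchSwinnertonDyer.Theorems.Rank1ResidualX1Defs

namespace Summit.BirchSwinnertonDyer.Rank1Residual.X10.UnitRoad

/-! ### §1. The UNIT ROAD off a literal integer model, without `hkato`, `hGr`, `h5` -/

/-- **`X(E/ℚ_∞) = 0` off a literal integer model at `p = 3` — NO named fact.** Target `W`
(`integralModelInt W = [a₁,…,a₆]`): `3 ∤ Δ` (good at `3`), `#W̃(𝔽₃) = n₃` with `3 ∤ 4 − n₃` (ordinary)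
and `3 ∤ n₃` (non-anomalous); census binders `htam : 3 ∤ ∏ c_ℓ`, `hSel : #Sel_{3^∞}(E/ℚ) = 1`. For the
cyclotomic `ℤ₃`-extension and every dual datum, `X(E/ℚ_∞) = 0` (`X10/UnitRoadProp38` §0: Greenberg's
Prop. 3.8 as proved in the tree by team n1011). No irreducibility, no `L`-value, no period is needed
for this half. Per pair; nothing booked. [cite: GreenbergLNM1716, §3 Prop. 3.8 and Remark (pp. 95–96)] -/
theorem subsingleton_dualSelmer_three_of_ainvs (a1 a2 a3 a4 a6 : ℤ) {W : WeierstrassCurve ℚ}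
    [W.IsElliptic] [W.IsGloballyMinimal] (hW : integralModelInt W = ⟨a1, a2, a3, a4, a6⟩)
    [Fact (Nat.Prime 3)] (n3 : ℕ) (h3Δ : ¬ (3 : ℤ) ∣ discOf [a1, a2, a3, a4, a6])
    (hcard3 : Nat.card (((⟨a1, a2, a3, a4, a6⟩ : WeierstrassCurve ℤ).map
      (Int.castRingHom (ZMod 3))).toAffine.Point) = n3)
    (hord3 : ¬ (3 : ℤ) ∣ (3 : ℤ) + 1 - n3) (hna3 : ¬ 3 ∣ n3) (htam : ¬ 3 ∣ W.tamagawaProduct)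
    (hSel : Nat.card (W.selmerGroupPInfty 3) = 1)
    {κ : ZpExtension ℚ 3} {γ : Field.absoluteGaloisGroup ℚ} (hκ : κ.IsCyclotomic)
    (hγ : κ.IsTopGenerator γ) (D : W.SelmerDualData κ γ) : Subsingleton D.X := by
  have hΔ : (⟨a1, a2, a3, a4, a6⟩ : WeierstrassCurve ℤ).Δ = discOf [a1, a2, a3, a4, a6] :=
    intCurve_Δ a1 a2 a3 a4 a6
  have hgood : W.HasGoodReductionAtPrime 3 :=
    hasGoodReductionAtPrime_of_not_dvd W 3 (by rw [minimalDiscriminantInt_eq hW, hΔ]; exact h3Δ)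
  have hord : ¬ ((3 : ℕ) : ℤ) ∣ W.frobeniusTrace 3 := by
    rw [frobeniusTrace_eq hW hcard3]; exact hord3
  have hna : ¬ 3 ∣ W.reductionPointCount 3 := by
    rw [WeierstrassCurve.reductionPointCount, hW, hcard3]; exact hna3
  exact subsingleton_dualSelmer_of_trivialArithmetic W 3 hgood hord hna htam hSel hκ hγ D

/-- **Mazur's main conjecture at `(E,3)` WITH `μ = 0`, for a cell with trivial `3`-primary arithmetic
given by a literal integer model — named fact `h3` ONLY.** Hypotheses = those of GEN 24's
`mazurMainConjecture_three_unitContent_of_ainvs_of_trivialArithmetic` (`X10/UnitRoad` §1) MINUS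
`hkato`, `hGr`, `h5`: target `W` (`integralModelInt W = [a₁,…,a₆]`), `3 ∤ Δ`, `#W̃(𝔽₃) = n₃` with
`3 ∤ 4 − n₃` (ordinary) AND `3 ∤ n₃` (non-anomalous), a good prime `ℓ ≠ 3` with `#W̃(𝔽_ℓ) = n` and
`X² − (ℓ+1−n)X + ℓ` root-free mod `3` (`E[3]` irreducible, Mazur 1978 Prop. 6.3 (1)); census binders
`htam`, `hL`, `hSel`. One-line instance of `mazurMainConjecture_with_mu_zero_of_trivialArithmetic_three_prop38`
(`X10/UnitRoadProp38` §2). Per pair; nothing booked.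
[cite: GreenbergLNM1716, §3 Prop. 3.8 and Remark (pp. 95–96)] [cite: Mazur1978, §6 Prop. 6.3 (1) (p. 153) and Cor. 4.1]
[cite: GreenbergVatsal2000, §3 Remark (3.4), Prop. (3.7)] -/
theorem mazurMainConjecture_three_unitContent_of_ainvs_of_trivialArithmetic_prop38
    (h3 : realPeriodRat_eq_unit_mul_plusPeriod_three)
    (a1 a2 a3 a4 a6 : ℤ) {W : WeierstrassCurve ℚ} [W.IsElliptic] [W.IsGloballyMinimal]
    (hW : integralModelInt W = ⟨a1, a2, a3, a4, a6⟩)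
    [Fact (Nat.Prime 3)] (ℓ n n3 : ℕ) [Fact ℓ.Prime]
    (h3Δ : ¬ (3 : ℤ) ∣ discOf [a1, a2, a3, a4, a6])
    (hcard3 : Nat.card (((⟨a1, a2, a3, a4, a6⟩ : WeierstrassCurve ℤ).map
      (Int.castRingHom (ZMod 3))).toAffine.Point) = n3)
    (hord3 : ¬ (3 : ℤ) ∣ (3 : ℤ) + 1 - n3) (hna3 : ¬ 3 ∣ n3)
    (hℓ3 : ℓ ≠ 3) (hℓΔ : ¬ (ℓ : ℤ) ∣ discOf [a1, a2, a3, a4, a6])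
    (hcard : Nat.card (((⟨a1, a2, a3, a4, a6⟩ : WeierstrassCurve ℤ).map
      (Int.castRingHom (ZMod ℓ))).toAffine.Point) = n)
    (hnoroot : ∀ t : ℕ, t < 3 → ¬ (3 : ℤ) ∣ (t : ℤ) ^ 2 - ((ℓ : ℤ) + 1 - n) * t + ℓ)
    (htam : ¬ 3 ∣ W.tamagawaProduct)
    (hL : ∃ q : ℚ, q ≠ 0 ∧ W.entireLFunction 1 / (W.realPeriodRat : ℂ) = (q : ℂ) ∧ padicValRat 3 q = 0)
    (hSel : Nat.card (W.selmerGroupPInfty 3) = 1) :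
    ∀ (κ : ZpExtension ℚ 3) (γ : Field.absoluteGaloisGroup ℚ),
        κ.IsCyclotomic → κ.IsTopGenerator γ → IsCyclotomicVariable 3 γ →
      ∀ [NeZero (W.conductorNorm ℤ)] (f : CuspForm (Gamma0 (W.conductorNorm ℤ)) 2),
        IsNewformOf W f → ∀ (ϖ : ℚ), (ϖ : ℝ) * W.realPeriodRat = plusPeriod f →
      ∀ (D : W.SelmerDualData κ γ), D.IsTorsion ∧
        ∃ g : IwasawaAlgebra 3, D.charIdeal = Ideal.span {g} ∧
          GreenbergVatsal2000.HasUnitContent g ∧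
          iwasawaToPowerSeries 3 g =
            PowerSeries.C (ϖ : ℚ_[3]) * padicLFunction f (unitRoot W 3 : ℚ_[3]) := by
  have hΔ : (⟨a1, a2, a3, a4, a6⟩ : WeierstrassCurve ℤ).Δ = discOf [a1, a2, a3, a4, a6] :=
    intCurve_Δ a1 a2 a3 a4 a6
  have hgood : W.HasGoodReductionAtPrime 3 :=
    hasGoodReductionAtPrime_of_not_dvd W 3 (by rw [minimalDiscriminantInt_eq hW, hΔ]; exact h3Δ)
  have hord : ¬ ((3 : ℕ) : ℤ) ∣ W.frobeniusTrace 3 := by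
    rw [frobeniusTrace_eq hW hcard3]; exact hord3
  have hna : ¬ 3 ∣ W.reductionPointCount 3 := by
    rw [WeierstrassCurve.reductionPointCount, hW, hcard3]; exact hna3
  have hirr : W.HasIrreducibleModPGaloisRep 3 := by
    refine hasIrreducibleModPGaloisRep_of_intModel_of_noroot hW 3 ℓ hℓ3 (by rw [hΔ]; exact hℓΔ) hcard
      (forall_zmod_of_forall_lt fun t ht h0 ↦ hnoroot t ht ?_)
    change ((3 : ℕ) : ℤ) ∣ _
    rw [← ZMod.intCast_zmod_eq_zero_iff_dvd]
    push_cast at h0 ⊢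
    linear_combination h0
  exact mazurMainConjecture_with_mu_zero_of_trivialArithmetic_three_prop38 h3 W hgood hord hirr hna
    htam hL hSel

/-- **Hence X_A3 at the pair, `MazurMainConjecture W 3`, for a cell with trivial `3`-primary
arithmetic given by a literal integer model — named fact `h3` only** (unit-content clause dropped).
Same hypotheses; per pair; nothing booked. [cite: GreenbergLNM1716, §3 Prop. 3.8 and Remark (pp. 95–96)]
[cite: CastellaGrossiSkinner2025, Introduction (MC)] -/
theorem mazurMainConjecture_three_of_ainvs_of_trivialArithmetic_prop38
    (h3 : realPeriodRat_eq_unit_mul_plusPeriod_three)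
    (a1 a2 a3 a4 a6 : ℤ) {W : WeierstrassCurve ℚ} [W.IsElliptic] [W.IsGloballyMinimal]
    (hW : integralModelInt W = ⟨a1, a2, a3, a4, a6⟩)
    [Fact (Nat.Prime 3)] (ℓ n n3 : ℕ) [Fact ℓ.Prime]
    (h3Δ : ¬ (3 : ℤ) ∣ discOf [a1, a2, a3, a4, a6])
    (hcard3 : Nat.card (((⟨a1, a2, a3, a4, a6⟩ : WeierstrassCurve ℤ).map
      (Int.castRingHom (ZMod 3))).toAffine.Point) = n3)
    (hord3 : ¬ (3 : ℤ) ∣ (3 : ℤ) + 1 - n3) (hna3 : ¬ 3 ∣ n3)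
    (hℓ3 : ℓ ≠ 3) (hℓΔ : ¬ (ℓ : ℤ) ∣ discOf [a1, a2, a3, a4, a6])
    (hcard : Nat.card (((⟨a1, a2, a3, a4, a6⟩ : WeierstrassCurve ℤ).map
      (Int.castRingHom (ZMod ℓ))).toAffine.Point) = n)
    (hnoroot : ∀ t : ℕ, t < 3 → ¬ (3 : ℤ) ∣ (t : ℤ) ^ 2 - ((ℓ : ℤ) + 1 - n) * t + ℓ)
    (htam : ¬ 3 ∣ W.tamagawaProduct)
    (hL : ∃ q : ℚ, q ≠ 0 ∧ W.entireLFunction 1 / (W.realPeriodRat : ℂ) = (q : ℂ) ∧ padicValRat 3 q = 0)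
    (hSel : Nat.card (W.selmerGroupPInfty 3) = 1) :
    MazurMainConjecture W 3 := by
  intro κ γ hκ hγ hγ' _ f hf ϖ hϖ D
  obtain ⟨hT, g, hg, -, hι⟩ :=
    mazurMainConjecture_three_unitContent_of_ainvs_of_trivialArithmetic_prop38 h3 a1 a2 a3 a4 a6 hW
      ℓ n n3 h3Δ hcard3 hord3 hna3 hℓ3 hℓΔ hcard hnoroot htam hL hSel κ γ hκ hγ hγ' f hf ϖ hϖ D
  exact ⟨hT, g, hg, hι⟩

/-! ### §2. The TRIVIAL-PARTNER ROAD off literal integer models, without `hkato`, `hGr`, `h5` -/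

/-- **Mazur's main conjecture at `(E,3)` WITH `μ = 0`, for ANY cell (any rank, any Tamagawa numbers,
any `Ш`) congruent mod `3` to a curve with trivial `3`-primary arithmetic — named facts `h3` and
Greenberg–Vatsal (1.4) ONLY.** Hypotheses = those of GEN 24's
`mazurMainConjecture_three_unitContent_of_ainvs_of_trivialPartner` (`X10/UnitRoad` §2) MINUS
`hkato`, `hGr`, `h5`: target `W` (`[a₁,…,a₆]`): `3 ∤ Δ`, `#W̃(𝔽₃) = n₃` with `3 ∤ 4 − n₃`, a good
`ℓ ≠ 3` with `#W̃(𝔽_ℓ) = n`, `X² − (ℓ+1−n)X + ℓ` root-free mod `3`; partner `A` (`[b₁,…,b₆]`):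
`3 ∤ Δ_A`, `#Ã(𝔽₃) = m₃` with `3 ∤ 4 − m₃` and `3 ∤ m₃`, census binders `htamA`, `hLA`, `hSelA`;
certificate C1 (`hC1`). Proof: §1's road for `A` (`X(A/ℚ_∞) = 0`, Greenberg Prop. 3.8 in the tree)
transported along C1 by `hGV`. Per pair; nothing booked.
[cite: GreenbergVatsal2000, Thm. (1.4) (arXiv p. 5)] [cite: GreenbergLNM1716, §3 Prop. 3.8 and Remark (pp. 95–96)]
[cite: Mazur1978, §6 Prop. 6.3 (1) (p. 153) and Cor. 4.1] -/
theorem mazurMainConjecture_three_unitContent_of_ainvs_of_trivialPartner_prop38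
    (h3 : realPeriodRat_eq_unit_mul_plusPeriod_three)
    (hGV : GreenbergVatsal2000.thm14_mainConjecture_transfer_of_torsionIso)
    (a1 a2 a3 a4 a6 : ℤ) {W : WeierstrassCurve ℚ} [W.IsElliptic] [W.IsGloballyMinimal]
    (hW : integralModelInt W = ⟨a1, a2, a3, a4, a6⟩)
    (b1 b2 b3 b4 b6 : ℤ) {A : WeierstrassCurve ℚ} [A.IsElliptic] [A.IsGloballyMinimal]
    (hA : integralModelInt A = ⟨b1, b2, b3, b4, b6⟩)
    [Fact (Nat.Prime 3)] (ℓ n n3 m3 : ℕ) [Fact ℓ.Prime]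
    (h3Δ : ¬ (3 : ℤ) ∣ discOf [a1, a2, a3, a4, a6])
    (hcard3 : Nat.card (((⟨a1, a2, a3, a4, a6⟩ : WeierstrassCurve ℤ).map
      (Int.castRingHom (ZMod 3))).toAffine.Point) = n3)
    (hord3 : ¬ (3 : ℤ) ∣ (3 : ℤ) + 1 - n3)
    (hℓ3 : ℓ ≠ 3) (hℓΔ : ¬ (ℓ : ℤ) ∣ discOf [a1, a2, a3, a4, a6])
    (hcard : Nat.card (((⟨a1, a2, a3, a4, a6⟩ : WeierstrassCurve ℤ).map
      (Int.castRingHom (ZMod ℓ))).toAffine.Point) = n)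
    (hnoroot : ∀ t : ℕ, t < 3 → ¬ (3 : ℤ) ∣ (t : ℤ) ^ 2 - ((ℓ : ℤ) + 1 - n) * t + ℓ)
    (h3ΔA : ¬ (3 : ℤ) ∣ discOf [b1, b2, b3, b4, b6])
    (hcard3A : Nat.card (((⟨b1, b2, b3, b4, b6⟩ : WeierstrassCurve ℤ).map
      (Int.castRingHom (ZMod 3))).toAffine.Point) = m3)
    (hord3A : ¬ (3 : ℤ) ∣ (3 : ℤ) + 1 - m3) (hna3A : ¬ 3 ∣ m3)
    (htamA : ¬ 3 ∣ A.tamagawaProduct)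
    (hLA : ∃ q : ℚ, q ≠ 0 ∧ A.entireLFunction 1 / (A.realPeriodRat : ℂ) = (q : ℂ) ∧ padicValRat 3 q = 0)
    (hSelA : Nat.card (A.selmerGroupPInfty 3) = 1)
    (hC1 : ∃ e : geomTorsion A ((3 : ℕ) : ℤ) ≃+ geomTorsion W ((3 : ℕ) : ℤ),
      ∀ (σ : Field.absoluteGaloisGroup ℚ) (P : geomTorsion A ((3 : ℕ) : ℤ)), e (σ • P) = σ • e P) :
    ∀ (κ : ZpExtension ℚ 3) (γ : Field.absoluteGaloisGroup ℚ),
        κ.IsCyclotomic → κ.IsTopGenerator γ → IsCyclotomicVariable 3 γ →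
      ∀ [NeZero (W.conductorNorm ℤ)] (f : CuspForm (Gamma0 (W.conductorNorm ℤ)) 2),
        IsNewformOf W f → ∀ (ϖ : ℚ), (ϖ : ℝ) * W.realPeriodRat = plusPeriod f →
      ∀ (D : W.SelmerDualData κ γ), D.IsTorsion ∧
        ∃ g : IwasawaAlgebra 3, D.charIdeal = Ideal.span {g} ∧
          GreenbergVatsal2000.HasUnitContent g ∧
          iwasawaToPowerSeries 3 g =
            PowerSeries.C (ϖ : ℚ_[3]) * padicLFunction f (unitRoot W 3 : ℚ_[3]) := by
  have hΔ : (⟨a1, a2, a3, a4, a6⟩ : WeierstrassCurve ℤ).Δ = discOf [a1, a2, a3, a4, a6] :=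
    intCurve_Δ a1 a2 a3 a4 a6
  have hΔA : (⟨b1, b2, b3, b4, b6⟩ : WeierstrassCurve ℤ).Δ = discOf [b1, b2, b3, b4, b6] :=
    intCurve_Δ b1 b2 b3 b4 b6
  have hgood : W.HasGoodReductionAtPrime 3 :=
    hasGoodReductionAtPrime_of_not_dvd W 3 (by rw [minimalDiscriminantInt_eq hW, hΔ]; exact h3Δ)
  have hord : ¬ ((3 : ℕ) : ℤ) ∣ W.frobeniusTrace 3 := by
    rw [frobeniusTrace_eq hW hcard3]; exact hord3
  have hgoodA : A.HasGoodReductionAtPrime 3 :=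
    hasGoodReductionAtPrime_of_not_dvd A 3 (by rw [minimalDiscriminantInt_eq hA, hΔA]; exact h3ΔA)
  have hordA : ¬ ((3 : ℕ) : ℤ) ∣ A.frobeniusTrace 3 := by
    rw [frobeniusTrace_eq hA hcard3A]; exact hord3A
  have hnaA : ¬ 3 ∣ A.reductionPointCount 3 := by
    rw [WeierstrassCurve.reductionPointCount, hA, hcard3A]; exact hna3A
  have hirr : W.HasIrreducibleModPGaloisRep 3 := by
    refine hasIrreducibleModPGaloisRep_of_intModel_of_noroot hW 3 ℓ hℓ3 (by rw [hΔ]; exact hℓΔ) hcard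
      (forall_zmod_of_forall_lt fun t ht h0 ↦ hnoroot t ht ?_)
    change ((3 : ℕ) : ℤ) ∣ _
    rw [← ZMod.intCast_zmod_eq_zero_iff_dvd]
    push_cast at h0 ⊢
    linear_combination h0
  obtain ⟨e, he⟩ := hC1
  have hirrA : A.HasIrreducibleModPGaloisRep 3 :=
    hasIrreducibleModPGaloisRep_of_torsionIso_symm e he hirr
  intro κ γ hκ hγ hγ'
  exact hGV A W 3 (by decide) hgoodA hordA hgood hord ⟨e, he⟩ hirrA hirr κ γ hκ hγ hγ'
    (mazurMainConjecture_with_mu_zero_of_trivialArithmetic_three_prop38 h3 A hgoodA hordA hirrA hnaA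
      htamA hLA hSelA κ γ hκ hγ hγ')

/-- **Hence X_A3 at the pair, `MazurMainConjecture W 3`, for ANY cell congruent mod `3` to a curve
with trivial `3`-primary arithmetic — named facts `h3` and Greenberg–Vatsal (1.4) only**
(unit-content clause dropped). Same hypotheses; per pair; nothing booked.
[cite: GreenbergVatsal2000, Thm. (1.4) (arXiv p. 5)] [cite: GreenbergLNM1716, §3 Prop. 3.8 and Remark (pp. 95–96)]
[cite: CastellaGrossiSkinner2025, Introduction (MC)] -/
theorem mazurMainConjecture_three_of_ainvs_of_trivialPartner_prop38
    (h3 : realPeriodRat_eq_unit_mul_plusPeriod_three)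
    (hGV : GreenbergVatsal2000.thm14_mainConjecture_transfer_of_torsionIso)
    (a1 a2 a3 a4 a6 : ℤ) {W : WeierstrassCurve ℚ} [W.IsElliptic] [W.IsGloballyMinimal]
    (hW : integralModelInt W = ⟨a1, a2, a3, a4, a6⟩)
    (b1 b2 b3 b4 b6 : ℤ) {A : WeierstrassCurve ℚ} [A.IsElliptic] [A.IsGloballyMinimal]
    (hA : integralModelInt A = ⟨b1, b2, b3, b4, b6⟩)
    [Fact (Nat.Prime 3)] (ℓ n n3 m3 : ℕ) [Fact ℓ.Prime]
    (h3Δ : ¬ (3 : ℤ) ∣ discOf [a1, a2, a3, a4, a6])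
    (hcard3 : Nat.card (((⟨a1, a2, a3, a4, a6⟩ : WeierstrassCurve ℤ).map
      (Int.castRingHom (ZMod 3))).toAffine.Point) = n3)
    (hord3 : ¬ (3 : ℤ) ∣ (3 : ℤ) + 1 - n3)
    (hℓ3 : ℓ ≠ 3) (hℓΔ : ¬ (ℓ : ℤ) ∣ discOf [a1, a2, a3, a4, a6])
    (hcard : Nat.card (((⟨a1, a2, a3, a4, a6⟩ : WeierstrassCurve ℤ).map
      (Int.castRingHom (ZMod ℓ))).toAffine.Point) = n)
    (hnoroot : ∀ t : ℕ, t < 3 → ¬ (3 : ℤ) ∣ (t : ℤ) ^ 2 - ((ℓ : ℤ) + 1 - n) * t + ℓ)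
    (h3ΔA : ¬ (3 : ℤ) ∣ discOf [b1, b2, b3, b4, b6])
    (hcard3A : Nat.card (((⟨b1, b2, b3, b4, b6⟩ : WeierstrassCurve ℤ).map
      (Int.castRingHom (ZMod 3))).toAffine.Point) = m3)
    (hord3A : ¬ (3 : ℤ) ∣ (3 : ℤ) + 1 - m3) (hna3A : ¬ 3 ∣ m3)
    (htamA : ¬ 3 ∣ A.tamagawaProduct)
    (hLA : ∃ q : ℚ, q ≠ 0 ∧ A.entireLFunction 1 / (A.realPeriodRat : ℂ) = (q : ℂ) ∧ padicValRat 3 q = 0)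
    (hSelA : Nat.card (A.selmerGroupPInfty 3) = 1)
    (hC1 : ∃ e : geomTorsion A ((3 : ℕ) : ℤ) ≃+ geomTorsion W ((3 : ℕ) : ℤ),
      ∀ (σ : Field.absoluteGaloisGroup ℚ) (P : geomTorsion A ((3 : ℕ) : ℤ)), e (σ • P) = σ • e P) :
    MazurMainConjecture W 3 := by
  intro κ γ hκ hγ hγ' _ f hf ϖ hϖ D
  obtain ⟨hT, g, hg, -, hι⟩ := mazurMainConjecture_three_unitContent_of_ainvs_of_trivialPartner_prop38
    h3 hGV a1 a2 a3 a4 a6 hW b1 b2 b3 b4 b6 hA ℓ n n3 m3 h3Δ hcard3 hord3 hℓ3 hℓΔ hcard hnoroot h3ΔA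
    hcard3A hord3A hna3A htamA hLA hSelA hC1 κ γ hκ hγ hγ' f hf ϖ hϖ D
  exact ⟨hT, g, hg, hι⟩

/-! ### §3. `BSD(E,3)` by the TRIVIAL-PARTNER road, without `hkato`, `h5` -/

/-- **`BSD(E,3)` for ANY N2 cell of analytic rank `0` congruent mod `3` to a curve with trivial
`3`-primary arithmetic — GEN 25's `bsdp_three_of_ainvs_of_trivialPartner_rankZero` WITHOUT `hkato`
and `h5`.** Same literal-model hypotheses; PUBLISHED binders left: `h3`, `hGV` (inputs of the road's
`MazurMainConjecture W 3`, §2) and `hGr`, `hmod`, `hGZK` (the MC ⇒ BSD bridge at analytic rank `0`,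
`Rank1Residual.bsdp_of_mazurMainConjecture_of_analyticRank_eq_zero`: Greenberg's Euler-characteristic
formula carries `#Ш(E)[3^∞]` and `∏ c_ℓ(E)` together; CGLS Thm. 5.1.4's deduction). Per pair; nothing
booked. [cite: GreenbergVatsal2000, Thm. (1.4) (arXiv p. 5)] [cite: GreenbergLNM1716, Thm. 4.1 (p. 102) and §3 Prop. 3.8 (p. 95)]
[cite: CastellaEtAl2021, Thm. 5.1.4 (proof, §5.1.3)] [cite: Miller2011LMS, Def. 1.1] -/
theorem bsdp_three_of_ainvs_of_trivialPartner_rankZero_prop38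
    (hGr : greenberg_charValue_rankZero) (h3 : realPeriodRat_eq_unit_mul_plusPeriod_three)
    (hGV : GreenbergVatsal2000.thm14_mainConjecture_transfer_of_torsionIso)
    (hmod : nonempty_modularParametrizationData)
    (hGZK : rank_eq_analyticRank_of_analyticRank_le_one)
    (a1 a2 a3 a4 a6 : ℤ) {W : WeierstrassCurve ℚ} [W.IsElliptic] [W.IsGloballyMinimal]
    (hW : integralModelInt W = ⟨a1, a2, a3, a4, a6⟩)
    (b1 b2 b3 b4 b6 : ℤ) {A : WeierstrassCurve ℚ} [A.IsElliptic] [A.IsGloballyMinimal]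
    (hA : integralModelInt A = ⟨b1, b2, b3, b4, b6⟩)
    [Fact (Nat.Prime 3)] (ℓ n n3 m3 : ℕ) [Fact ℓ.Prime]
    (h3Δ : ¬ (3 : ℤ) ∣ discOf [a1, a2, a3, a4, a6])
    (hcard3 : Nat.card (((⟨a1, a2, a3, a4, a6⟩ : WeierstrassCurve ℤ).map
      (Int.castRingHom (ZMod 3))).toAffine.Point) = n3)
    (hord3 : ¬ (3 : ℤ) ∣ (3 : ℤ) + 1 - n3)
    (hℓ3 : ℓ ≠ 3) (hℓΔ : ¬ (ℓ : ℤ) ∣ discOf [a1, a2, a3, a4, a6])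
    (hcard : Nat.card (((⟨a1, a2, a3, a4, a6⟩ : WeierstrassCurve ℤ).map
      (Int.castRingHom (ZMod ℓ))).toAffine.Point) = n)
    (hnoroot : ∀ t : ℕ, t < 3 → ¬ (3 : ℤ) ∣ (t : ℤ) ^ 2 - ((ℓ : ℤ) + 1 - n) * t + ℓ)
    (h3ΔA : ¬ (3 : ℤ) ∣ discOf [b1, b2, b3, b4, b6])
    (hcard3A : Nat.card (((⟨b1, b2, b3, b4, b6⟩ : WeierstrassCurve ℤ).map
      (Int.castRingHom (ZMod 3))).toAffine.Point) = m3)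
    (hord3A : ¬ (3 : ℤ) ∣ (3 : ℤ) + 1 - m3) (hna3A : ¬ 3 ∣ m3)
    (htamA : ¬ 3 ∣ A.tamagawaProduct)
    (hLA : ∃ q : ℚ, q ≠ 0 ∧ A.entireLFunction 1 / (A.realPeriodRat : ℂ) = (q : ℂ) ∧ padicValRat 3 q = 0)
    (hSelA : Nat.card (A.selmerGroupPInfty 3) = 1)
    (hC1 : ∃ e : geomTorsion A ((3 : ℕ) : ℤ) ≃+ geomTorsion W ((3 : ℕ) : ℤ),
      ∀ (σ : Field.absoluteGaloisGroup ℚ) (P : geomTorsion A ((3 : ℕ) : ℤ)), e (σ • P) = σ • e P)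
    (hr0 : W.analyticRank = 0) :
    BSDp W 3 :=
  Rank1Residual.bsdp_of_mazurMainConjecture_of_analyticRank_eq_zero hGr hmod hGZK (by decide)
    (goodOrd_three_of_ainvs a1 a2 a3 a4 a6 hW n3 h3Δ hcard3 hord3) hr0
    (mazurMainConjecture_three_of_ainvs_of_trivialPartner_prop38 h3 hGV a1 a2 a3 a4 a6 hW
      b1 b2 b3 b4 b6 hA ℓ n n3 m3 h3Δ hcard3 hord3 hℓ3 hℓΔ hcard hnoroot h3ΔA hcard3A hord3A hna3A
      htamA hLA hSelA hC1)

/-- **`BSD(E,3)` for ANY N2 cell of analytic rank `1` congruent mod `3` to a curve with trivial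
`3`-primary arithmetic, MODULO the Schneider certificate — GEN 25's
`bsdp_three_of_ainvs_of_trivialPartner_rankOne_of_schneider` WITHOUT `hkato`, `hGr`, `h5`.** Same
literal-model hypotheses; PUBLISHED binders left: `h3`, `hGV` (the road), `hS` (Perrin-Riou–Schneider,
`Schneider1985_order_charGenerator_odd`), `hPR` (Perrin-Riou 1987 §1.4), `hMT` (Mazur–Tate `σ`),
`hmod`, `hGZK` (the MC ⇒ BSD bridge at analytic rank `1`,
`Rank1Residual.bsdp_of_mazurMainConjecture_of_analyticRank_eq_one_of_schneider_odd`, which does not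
use Greenberg's Thm. 4.1); the per-curve CERTIFICATE `hSch` (non-degeneracy of the canonical
cyclotomic `3`-adic height; displayed, not discharged). Per pair; nothing booked.
[cite: GreenbergVatsal2000, Thm. (1.4) (arXiv p. 5)] [cite: GreenbergLNM1716, §3 Prop. 3.8 (p. 95)]
[cite: PerrinRiou1987, §1.4 Cor. 1.8] [cite: BalakrishnanMullerStein2015, Thm. 1.7]
[cite: MazurTate1991, Thm. 3.1] [cite: Miller2011LMS, Def. 1.1] -/
theorem bsdp_three_of_ainvs_of_trivialPartner_rankOne_of_schneider_prop38
    (h3 : realPeriodRat_eq_unit_mul_plusPeriod_three)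
    (hGV : GreenbergVatsal2000.thm14_mainConjecture_transfer_of_torsionIso)
    (hS : Schneider1985_order_charGenerator_odd) (hPR : perrinRiou_rankOne_leadingTerms_odd)
    (hMT : mazur_tate_sigma_exists_odd) (hmod : nonempty_modularParametrizationData)
    (hGZK : rank_eq_analyticRank_of_analyticRank_le_one)
    (a1 a2 a3 a4 a6 : ℤ) {W : WeierstrassCurve ℚ} [W.IsElliptic] [W.IsGloballyMinimal]
    (hW : integralModelInt W = ⟨a1, a2, a3, a4, a6⟩)
    (b1 b2 b3 b4 b6 : ℤ) {A : WeierstrassCurve ℚ} [A.IsElliptic] [A.IsGloballyMinimal]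
    (hA : integralModelInt A = ⟨b1, b2, b3, b4, b6⟩)
    [Fact (Nat.Prime 3)] (ℓ n n3 m3 : ℕ) [Fact ℓ.Prime]
    (h3Δ : ¬ (3 : ℤ) ∣ discOf [a1, a2, a3, a4, a6])
    (hcard3 : Nat.card (((⟨a1, a2, a3, a4, a6⟩ : WeierstrassCurve ℤ).map
      (Int.castRingHom (ZMod 3))).toAffine.Point) = n3)
    (hord3 : ¬ (3 : ℤ) ∣ (3 : ℤ) + 1 - n3)
    (hℓ3 : ℓ ≠ 3) (hℓΔ : ¬ (ℓ : ℤ) ∣ discOf [a1, a2, a3, a4, a6])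
    (hcard : Nat.card (((⟨a1, a2, a3, a4, a6⟩ : WeierstrassCurve ℤ).map
      (Int.castRingHom (ZMod ℓ))).toAffine.Point) = n)
    (hnoroot : ∀ t : ℕ, t < 3 → ¬ (3 : ℤ) ∣ (t : ℤ) ^ 2 - ((ℓ : ℤ) + 1 - n) * t + ℓ)
    (h3ΔA : ¬ (3 : ℤ) ∣ discOf [b1, b2, b3, b4, b6])
    (hcard3A : Nat.card (((⟨b1, b2, b3, b4, b6⟩ : WeierstrassCurve ℤ).map
      (Int.castRingHom (ZMod 3))).toAffine.Point) = m3)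
    (hord3A : ¬ (3 : ℤ) ∣ (3 : ℤ) + 1 - m3) (hna3A : ¬ 3 ∣ m3)
    (htamA : ¬ 3 ∣ A.tamagawaProduct)
    (hLA : ∃ q : ℚ, q ≠ 0 ∧ A.entireLFunction 1 / (A.realPeriodRat : ℂ) = (q : ℂ) ∧ padicValRat 3 q = 0)
    (hSelA : Nat.card (A.selmerGroupPInfty 3) = 1)
    (hC1 : ∃ e : geomTorsion A ((3 : ℕ) : ℤ) ≃+ geomTorsion W ((3 : ℕ) : ℤ),
      ∀ (σ : Field.absoluteGaloisGroup ℚ) (P : geomTorsion A ((3 : ℕ) : ℤ)), e (σ • P) = σ • e P)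
    (hr1 : W.analyticRank = 1)
    (hSch : ∀ Dh : PAdicHeightData W 3, Dh.IsCanonical → SchneiderConjecture Dh) :
    BSDp W 3 :=
  Rank1Residual.bsdp_of_mazurMainConjecture_of_analyticRank_eq_one_of_schneider_odd hS hPR hMT hmod
    hGZK (by decide) (goodOrd_three_of_ainvs a1 a2 a3 a4 a6 hW n3 h3Δ hcard3 hord3) hr1 hSch
    (mazurMainConjecture_three_of_ainvs_of_trivialPartner_prop38 h3 hGV a1 a2 a3 a4 a6 hW
      b1 b2 b3 b4 b6 hA ℓ n n3 m3 h3Δ hcard3 hord3 hℓ3 hℓΔ hcard hnoroot h3ΔA hcard3A hord3A hna3A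
      htamA hLA hSelA hC1)

end Summit.BirchSwinnertonDyer.Rank1Residual.X10.UnitRoad
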